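import Mathlib
import Summits.PneNP.PneNP.Theorems.OverlapGapAlgebraSearchHardWindowEnsembleOGPHolds
import Literature.Computability.Complexity.RandomKSatLowDegreeHardness

/-!
# Route OverlapGapAlgebra, crux `SearchHardWindow` (stmt-PneNP-2460): Huang–Sellke 2025 Cor. 3.21
# (now the tree theorem `huangSellke2025KSat_holds`, degrees `o(n)`) — UNIFORM threshold and
# INTERNAL RANDOMNESS

The named fact `Literature.Computability.Complexity.HuangSellke2025KSat` is a THEOREM
(`huangSellke2025KSat_holds`, `…SearchHardWindowEnsembleOGPHolds.lean`, line `Sketch` of this crux,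
lead prover-line-stmt-PneNP-2460-c2: the ensemble OGP on the resampling chain). Its printed shape
quantifies over SEQUENCES of maps, so the threshold in `n` may a priori depend on the sequence. This
file records the two formal strengthenings that every user wants, by the arguments of
`…VanishingUniform.lean` (this seat; there for the independent macro-step theorem at degrees
`o(n/log² n)`) run on `huangSellke2025KSat_holds`:

* `huangSellke2025KSat_uniform` — for `k ≥ k₀`, `C > 0`, `D_n = o(n)` and `ε > 0`, eventually in `n`,
  EVERY `F : instances → ℝⁿ` of coordinate degree `≤ D_n` and energy `≤ C n · #Inst` has at most
  `ε · #Inst` saturated sign-successes (diagonal choice of a worst map at each `n`);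
* `huangSellke2025KSat_randomized` — internal randomness `ω ∈ Ω` (finite), average energy
  `≤ C n · #Inst`: `#{(ω, Φ) : saturated ∧ solves} ≤ ε · #Inst · #Ω` eventually (Markov in `ω`) — the
  `ω` of Huang–Sellke's `A°(y, ω)` (part of the fact's `TODO(general form)`).

References: B. Huang, M. Sellke, arXiv:2501.06427, Cor. 3.21 [HuangSellke2025].
-/

noncomputable section

namespace Summit.PneNP.PneNP.Theorems

set_option linter.dupNamespace false -- `Summit.PneNP.PneNP.…`: summit = sub-problem (D-0017)

open Finset Filter Asymptotics
open Literature.Computability.Complexity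
open scoped Classical

/-- **Huang–Sellke 2025 Cor. 3.21 with a uniform threshold (unconditional).** For `k ≥ k₀`,
`C > 0`, `D_n = o(n)` and `ε > 0`: eventually in `n`, with `m = ⌊5·2^k log k/k · n⌋₊`, every
`F : (Fin m → Fin k → Fin n × Bool) → (Fin n → ℝ)` whose coordinates have coordinate degree `≤ D_n`
and whose energy is `≤ C n · #Inst` satisfies
`#{Φ : ∀ v, |F(Φ)_v| ≥ 1 ∧ sgn F(Φ) satisfies Φ} ≤ ε · #Inst`. [HuangSellke2025, Cor. 3.21] -/
theorem huangSellke2025KSat_uniform :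
    ∃ k₀ : ℕ, ∀ k : ℕ, k₀ ≤ k → ∀ C : ℝ, 0 < C → ∀ D : ℕ → ℕ,
      (fun n : ℕ => (D n : ℝ)) =o[atTop] (fun n : ℕ => (n : ℝ)) →
      ∀ ε : ℝ, 0 < ε → ∀ᶠ n : ℕ in atTop, ∀ m : ℕ, m = ⌊5 * 2 ^ k * Real.log k / k * n⌋₊ →
        ∀ F : (Fin m → Fin k → Fin n × Bool) → Fin n → ℝ,
          (∀ v : Fin n, IsCoordDegreeLE (D n)
            (fun y : Fin m × Fin k → Fin n × Bool => F (Function.curry y) v)) →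
          ∑ Φ : Fin m → Fin k → Fin n × Bool, ∑ v : Fin n, F Φ v ^ 2
              ≤ C * n * Fintype.card (Fin m → Fin k → Fin n × Bool) →
          ((univ.filter fun Φ : Fin m → Fin k → Fin n × Bool =>
              (∀ v : Fin n, 1 ≤ |F Φ v|) ∧
              ∀ i : Fin m, ∃ j : Fin k, decide (0 ≤ F Φ (Φ i j).1) = (Φ i j).2).card : ℝ)
            ≤ ε * Fintype.card (Fin m → Fin k → Fin n × Bool) := by
  obtain ⟨k₀, hk₀⟩ := huangSellke2025KSat_holds
  refine ⟨k₀, fun k hk C hC D hD ε hε => ?_⟩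
  -- the property at level `n`, with `m = M n` substituted
  let M : ℕ → ℕ := fun n => ⌊5 * 2 ^ k * Real.log k / k * n⌋₊
  let Q : (n : ℕ) → ((Fin (M n) → Fin k → Fin n × Bool) → Fin n → ℝ) → Prop := fun n F =>
    (∀ v : Fin n, IsCoordDegreeLE (D n)
      (fun y : Fin (M n) × Fin k → Fin n × Bool => F (Function.curry y) v)) →
    ∑ Φ : Fin (M n) → Fin k → Fin n × Bool, ∑ v : Fin n, F Φ v ^ 2
        ≤ C * n * Fintype.card (Fin (M n) → Fin k → Fin n × Bool) →
    ((univ.filter fun Φ : Fin (M n) → Fin k → Fin n × Bool =>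
        (∀ v : Fin n, 1 ≤ |F Φ v|) ∧
        ∀ i : Fin (M n), ∃ j : Fin k, decide (0 ≤ F Φ (Φ i j).1) = (Φ i j).2).card : ℝ)
      ≤ ε * Fintype.card (Fin (M n) → Fin k → Fin n × Bool)
  -- it suffices to prove it for `m = M n`
  suffices H : ∀ᶠ n : ℕ in atTop, ∀ F, Q n F by
    filter_upwards [H] with n hn m hm F
    subst hm
    exact hn F
  by_contra hnot
  -- a worst map wherever the property fails
  let bad : ℕ → Prop := fun n => ∃ F, ¬ Q n F
  obtain ⟨Fb, hFb⟩ : ∃ Fb : (n : ℕ) → (Fin (M n) → Fin k → Fin n × Bool) → Fin n → ℝ,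
      ∀ n, bad n → ¬ Q n (Fb n) := by
    refine ⟨fun n => if h : bad n then h.choose else fun _ _ => 0, fun n hn => ?_⟩
    simp only [dif_pos hn]
    exact hn.choose_spec
  have hFb' : ∀ n, bad n →
      (∀ v : Fin n, IsCoordDegreeLE (D n)
        (fun y : Fin (M n) × Fin k → Fin n × Bool => Fb n (Function.curry y) v)) ∧
      ∑ Φ : Fin (M n) → Fin k → Fin n × Bool, ∑ v : Fin n, Fb n Φ v ^ 2
          ≤ C * n * Fintype.card (Fin (M n) → Fin k → Fin n × Bool) ∧
      ε * Fintype.card (Fin (M n) → Fin k → Fin n × Bool) <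
        ((univ.filter fun Φ : Fin (M n) → Fin k → Fin n × Bool =>
          (∀ v : Fin n, 1 ≤ |Fb n Φ v|) ∧
          ∀ i : Fin (M n), ∃ j : Fin k, decide (0 ≤ Fb n Φ (Φ i j).1) = (Φ i j).2).card : ℝ) := by
    intro n hn
    have h := hFb n hn
    simp only [Q, Classical.not_imp, not_le] at h
    exact ⟨h.1, h.2.1, h.2.2⟩
  -- the diagonal sequence: the worst map where the property fails, zero elsewhere and off `m = M n`
  let Fs : (n m : ℕ) → (Fin m → Fin k → Fin n × Bool) → Fin n → ℝ := fun n m Φ v =>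
    if h : bad n ∧ m = M n then Fb n (fun a b => Φ (a.cast h.2.symm) b) v else 0
  have hdeg : ∀ (n m : ℕ) (v : Fin n), IsCoordDegreeLE (D n)
      (fun y : Fin m × Fin k → Fin n × Bool => Fs n m (Function.curry y) v) := by
    intro n m v
    by_cases h : bad n ∧ m = M n
    · obtain ⟨hb, hm⟩ := h
      subst hm
      have hfun : (fun y : Fin (M n) × Fin k → Fin n × Bool => Fs n (M n) (Function.curry y) v) =
          fun y => Fb n (Function.curry y) v := by
        funext y
        simp only [Fs, dif_pos (show bad n ∧ M n = M n from ⟨hb, rfl⟩)]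
        rfl
      rw [hfun]
      exact (hFb' n hb).1 v
    · have hfun : (fun y : Fin m × Fin k → Fin n × Bool => Fs n m (Function.curry y) v) =
          fun _ => 0 := by
        funext y; simp only [Fs, dif_neg h]
      rw [hfun]; exact IsCoordDegreeLE.zero _
  have hener : ∀ n m : ℕ, m = ⌊5 * 2 ^ k * Real.log k / k * n⌋₊ →
      ∑ Φ : Fin m → Fin k → Fin n × Bool, ∑ v : Fin n, Fs n m Φ v ^ 2
        ≤ C * n * Fintype.card (Fin m → Fin k → Fin n × Bool) := by
    intro n m hm
    by_cases hb : bad n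
    · subst hm
      have hsum : ∑ Φ : Fin (M n) → Fin k → Fin n × Bool, ∑ v : Fin n, Fs n (M n) Φ v ^ 2 =
          ∑ Φ : Fin (M n) → Fin k → Fin n × Bool, ∑ v : Fin n, Fb n Φ v ^ 2 := by
        refine Finset.sum_congr rfl fun Φ _ => Finset.sum_congr rfl fun v _ => ?_
        simp only [Fs, dif_pos (show bad n ∧ M n = M n from ⟨hb, rfl⟩)]
        rfl
      rw [hsum]
      exact (hFb' n hb).2.1
    · have h0 : ∑ Φ : Fin m → Fin k → Fin n × Bool, ∑ v : Fin n, Fs n m Φ v ^ 2 = 0 := by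
        have hnb : ¬ (bad n ∧ m = M n) := fun h => hb h.1
        simp only [Fs, dif_neg hnb]; simp
      rw [h0]; positivity
  have hev := hk₀ k hk C hC D hD Fs hdeg hener ε hε
  -- the property fails frequently, but the diagonal sequence is eventually fine: contradiction
  have hfreq : ∃ᶠ n : ℕ in atTop, bad n := by
    rw [Filter.not_eventually] at hnot
    refine hnot.mono fun n hn => ?_
    simp only [not_forall] at hn
    exact hn
  obtain ⟨n, hbn, hevn⟩ := (hfreq.and_eventually hev).exists
  have hcount := hevn (M n) rfl
  have hsame : (univ.filter fun Φ : Fin (M n) → Fin k → Fin n × Bool =>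
      (∀ v : Fin n, 1 ≤ |Fs n (M n) Φ v|) ∧
      ∀ i : Fin (M n), ∃ j : Fin k, decide (0 ≤ Fs n (M n) Φ (Φ i j).1) = (Φ i j).2) =
      (univ.filter fun Φ : Fin (M n) → Fin k → Fin n × Bool =>
        (∀ v : Fin n, 1 ≤ |Fb n Φ v|) ∧
        ∀ i : Fin (M n), ∃ j : Fin k, decide (0 ≤ Fb n Φ (Φ i j).1) = (Φ i j).2) := by
    refine Finset.filter_congr fun Φ _ => ?_
    have hF : ∀ v, Fs n (M n) Φ v = Fb n Φ v := fun v => by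
      simp only [Fs, dif_pos (show bad n ∧ M n = M n from ⟨hbn, rfl⟩)]
      rfl
    simp only [hF]
  rw [hsame] at hcount
  exact absurd hcount (not_le.2 (hFb' n hbn).2.2)

/-- **Huang–Sellke 2025 Cor. 3.21 with internal randomness (unconditional).** For `k ≥ k₀`,
`C > 0`, `D_n = o(n)` and `ε > 0`: eventually in `n`, with `m = ⌊5·2^k log k/k · n⌋₊`, for
every finite nonempty index type `Ω` ("random seeds") and every family `F : Ω → instances → ℝⁿ` of
maps of coordinate degree `≤ D_n` with AVERAGE energy `Σ_ω Σ_Φ ‖F ω Φ‖² ≤ C n · #Inst · #Ω`, the pairs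
`(ω, Φ)` on which every `|F ω Φ v| ≥ 1` and the signs of `F ω Φ` satisfy `Φ` number at most
`ε · #Inst · #Ω` — i.e. `P_{Φ, ω}[saturated ∧ solves] ≤ ε`. [HuangSellke2025, Cor. 3.21] -/
theorem huangSellke2025KSat_randomized :
    ∃ k₀ : ℕ, ∀ k : ℕ, k₀ ≤ k → ∀ C : ℝ, 0 < C → ∀ D : ℕ → ℕ,
      (fun n : ℕ => (D n : ℝ)) =o[atTop] (fun n : ℕ => (n : ℝ)) →
      ∀ ε : ℝ, 0 < ε → ∀ᶠ n : ℕ in atTop, ∀ m : ℕ, m = ⌊5 * 2 ^ k * Real.log k / k * n⌋₊ →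
        ∀ (Ω : Type) [Fintype Ω], ∀ F : Ω → (Fin m → Fin k → Fin n × Bool) → Fin n → ℝ,
          (∀ (ω : Ω) (v : Fin n), IsCoordDegreeLE (D n)
            (fun y : Fin m × Fin k → Fin n × Bool => F ω (Function.curry y) v)) →
          ∑ ω : Ω, ∑ Φ : Fin m → Fin k → Fin n × Bool, ∑ v : Fin n, F ω Φ v ^ 2
              ≤ C * n * Fintype.card (Fin m → Fin k → Fin n × Bool) * Fintype.card Ω →
          ((univ.filter fun p : Ω × (Fin m → Fin k → Fin n × Bool) =>
              (∀ v : Fin n, 1 ≤ |F p.1 p.2 v|) ∧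
              ∀ i : Fin m, ∃ j : Fin k, decide (0 ≤ F p.1 p.2 (p.2 i j).1) = (p.2 i j).2).card : ℝ)
            ≤ ε * Fintype.card (Fin m → Fin k → Fin n × Bool) * Fintype.card Ω := by
  obtain ⟨k₀, hk₀⟩ := huangSellke2025KSat_uniform
  refine ⟨k₀, fun k hk C hC D hD ε hε => ?_⟩
  have h := hk₀ k hk (2 * C / ε) (by positivity) D hD (ε / 2) (half_pos hε)
  filter_upwards [h, eventually_ge_atTop 1] with n hn hn1 m hm Ω _ F hdeg hener
  set Qr : ℝ := (Fintype.card (Fin m → Fin k → Fin n × Bool) : ℝ) with hQr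
  have hQr0 : 0 ≤ Qr := Nat.cast_nonneg _
  haveI : Nonempty (Fin n × Bool) := ⟨(⟨0, hn1⟩, true)⟩
  have hQpos : 0 < Qr := by rw [hQr]; exact_mod_cast Fintype.card_pos
  have hnr : (0 : ℝ) < n := by exact_mod_cast hn1
  -- energies and success counts per seed
  set E : Ω → ℝ := fun ω => ∑ Φ : Fin m → Fin k → Fin n × Bool, ∑ v : Fin n, F ω Φ v ^ 2 with hE
  set S : Ω → ℕ := fun ω => (univ.filter fun Φ : Fin m → Fin k → Fin n × Bool =>
      (∀ v : Fin n, 1 ≤ |F ω Φ v|) ∧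
      ∀ i : Fin m, ∃ j : Fin k, decide (0 ≤ F ω Φ (Φ i j).1) = (Φ i j).2).card with hS
  have hE0 : ∀ ω, 0 ≤ E ω := fun ω => by rw [hE]; positivity
  have hSle : ∀ ω, (S ω : ℝ) ≤ Qr := fun ω => by
    rw [hS, hQr]; exact_mod_cast Finset.card_le_univ _
  -- good seeds: energy below the boosted level
  have hgood : ∀ ω, E ω ≤ 2 * C / ε * n * Qr → (S ω : ℝ) ≤ ε / 2 * Qr := fun ω hω =>
    hn m hm (F ω) (hdeg ω) hω
  -- the pair count is the sum of the per-seed counts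
  have hpair : ((univ.filter fun p : Ω × (Fin m → Fin k → Fin n × Bool) =>
      (∀ v : Fin n, 1 ≤ |F p.1 p.2 v|) ∧
      ∀ i : Fin m, ∃ j : Fin k, decide (0 ≤ F p.1 p.2 (p.2 i j).1) = (p.2 i j).2).card : ℝ) =
      ∑ ω, (S ω : ℝ) := by
    simp only [hS, Finset.card_filter, Nat.cast_sum, Fintype.sum_prod_type]
  rw [hpair]
  -- Markov: the bad seeds are few
  set bad : Finset Ω := univ.filter fun ω => 2 * C / ε * n * Qr < E ω with hbad
  have hbadcard : (bad.card : ℝ) * (2 * C / ε * n * Qr) ≤ C * n * Qr * Fintype.card Ω := by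
    calc (bad.card : ℝ) * (2 * C / ε * n * Qr) = ∑ ω ∈ bad, 2 * C / ε * n * Qr := by
          rw [Finset.sum_const, nsmul_eq_mul]
      _ ≤ ∑ ω ∈ bad, E ω := Finset.sum_le_sum fun ω hω => by
          simp only [hbad, Finset.mem_filter, Finset.mem_univ, true_and] at hω; exact hω.le
      _ ≤ ∑ ω, E ω := Finset.sum_le_sum_of_subset_of_nonneg (Finset.subset_univ _)
          fun ω _ _ => hE0 ω
      _ ≤ C * n * Qr * Fintype.card Ω := hener
  -- split the sum over good and bad seeds
  have hsplit : ∑ ω, (S ω : ℝ) = ∑ ω ∈ univ.filter (fun ω => ¬ 2 * C / ε * n * Qr < E ω), (S ω : ℝ) +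
      ∑ ω ∈ bad, (S ω : ℝ) := by
    rw [hbad, ← Finset.sum_filter_add_sum_filter_not univ (fun ω => 2 * C / ε * n * Qr < E ω),
      add_comm]
  rw [hsplit]
  have h1 : ∑ ω ∈ univ.filter (fun ω => ¬ 2 * C / ε * n * Qr < E ω), (S ω : ℝ) ≤
      ε / 2 * Qr * Fintype.card Ω := by
    calc ∑ ω ∈ univ.filter (fun ω => ¬ 2 * C / ε * n * Qr < E ω), (S ω : ℝ)
        ≤ ∑ ω ∈ univ.filter (fun ω => ¬ 2 * C / ε * n * Qr < E ω), ε / 2 * Qr :=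
          Finset.sum_le_sum fun ω hω => by
            simp only [Finset.mem_filter, Finset.mem_univ, true_and, not_lt] at hω
            exact hgood ω hω
      _ = ((univ.filter (fun ω => ¬ 2 * C / ε * n * Qr < E ω)).card : ℝ) * (ε / 2 * Qr) := by
          rw [Finset.sum_const, nsmul_eq_mul]
      _ ≤ (Fintype.card Ω : ℝ) * (ε / 2 * Qr) := by
          refine mul_le_mul_of_nonneg_right ?_ (by positivity)
          exact_mod_cast Finset.card_le_univ _
      _ = ε / 2 * Qr * Fintype.card Ω := by ring
  have h2 : ∑ ω ∈ bad, (S ω : ℝ) ≤ ε / 2 * Qr * Fintype.card Ω := by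
    have hbc : (bad.card : ℝ) ≤ ε / 2 * Fintype.card Ω := by
      have hpos : 0 < 2 * C / ε * n * Qr := by positivity
      rw [← mul_le_mul_iff_left₀ hpos]
      calc (bad.card : ℝ) * (2 * C / ε * n * Qr) ≤ C * n * Qr * Fintype.card Ω := hbadcard
        _ = ε / 2 * Fintype.card Ω * (2 * C / ε * n * Qr) := by field_simp
    calc ∑ ω ∈ bad, (S ω : ℝ) ≤ ∑ ω ∈ bad, Qr := Finset.sum_le_sum fun ω _ => hSle ω
      _ = (bad.card : ℝ) * Qr := by rw [Finset.sum_const, nsmul_eq_mul]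
      _ ≤ ε / 2 * Fintype.card Ω * Qr := mul_le_mul_of_nonneg_right hbc hQr0
      _ = ε / 2 * Qr * Fintype.card Ω := by ring
  calc _ ≤ ε / 2 * Qr * Fintype.card Ω + ε / 2 * Qr * Fintype.card Ω := add_le_add h1 h2
    _ = ε * Qr * Fintype.card Ω := by ring

end Summit.PneNP.PneNP.Theorems

end
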